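import Literature.NumberTheory.Automorphic.SmoothTraceBoxChar            -- ★ `isAdmissible_twist_comp_fst` : `ρ ⊠ χ` is admissible for `ρ` admissible, `ker χ` open
import Literature.NumberTheory.Automorphic.HeckeEigencharacterPackage    -- ★ `IrrClass.IsAdmissible`, `IrrClass.isAdmissible_mk`
import HarnessLib

/-!
# R90-TF · S4 «Ch. 13.1–2» — helper F1 of socket S4#B1 `stub_R90_S4_H_admissible`: the box `c ⊠ χ` of an ADMISSIBLE class is admissible

Cell `hodgecm-mathlib`, crux H413 (`stmt-HodgeConjecture-24833`, lane `--supports … --as helper`), route of record `HCCMUnconditional`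
(no route verbs; count-neutral).  Programme R90-TF (HUMAN RULING «R90-TF SLAB — MAX PUSH»; brief `director/R90-BRIEF.v2.md`
1f40d54518340a35), section S4 = Rogawski Ch. 13.1–2 (base `R90-C131`); seat R90-C131-p01 (g0), dealt BY NAME «p01 → S4#B1
`stub_R90_S4_H_admissible` — ROAD TRANSPORT, F1» (`R90/S4/DEAL-S4-WAVE1.K2E2-plan-g6.md`, `R90/S4/DEAL-S4B-WAVE1.R90-C131-typ2-g0.md`).

CONTENT (one theorem, generic representation theory; no `def`, no instance, no notation, no named fact, no `sorry`):
for topological groups `G, G₁` (one universe, as ★ `IrrClass`), a smooth character `χ : G₁ →* ℂˣ` (`ker χ` open) and an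
ADMISSIBLE class `c ∈ Irr(G)` (★ `IrrClass.IsAdmissible`, `Automorphic/HeckeEigencharacterPackage` :303), the boxed class
`c ⊠ χ ∈ Irr(G × G₁)` (★ `IrrClass.boxChar`, `Automorphic/IrreducibleClassesBoxChar` :192) is admissible.  On a representative
`r` the action of `r ⊠ χ` is `(r.ρ ∘ pr₁) ⊗ (χ ∘ pr₂)` (★ `SmoothIrrep.boxChar_ρ`), which is admissible by ★
`isAdmissible_twist_comp_fst` (`Automorphic/SmoothTraceBoxChar` :129: pull-back along the open continuous `pr₁`, ★
`IsAdmissible.comp_of_isOpenMap`, then twist by the smooth `χ ∘ pr₂`, ★ `Representation.IsAdmissible.twist`: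
`V^{K}(ρ ⊗ ν) ≤ V^{K ∩ ker ν}(ρ)`).  Searched before typing (2026-09-04): `lean search 'isAdmissible_boxChar|IsAdmissible.boxChar'`
— 0 hits at the CLASS level; the representation-level ★ `isAdmissible_twist_comp_fst` is cited, not restated.

USE: socket S4#B1 (members of an `H_v = U(Φ₂)_v × U(Φ₁)_v`-packet `O ⊠ χ₁` are admissible) = this ∘ ★ `IrrClass.IsAdmissible.comap`
(`Automorphic/IrreducibleClassesComapSpherical` :93) — composed in `Theorems/R90S4HAdmissible.lean`.

HONEST LABEL: HC_CM is proved only modulo the 7 printed citations (2 remaining named inputs: hLiu418 = stmt-HodgeConjecture-24832,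
h413 = stmt-HodgeConjecture-24833) until rung 0 closes; this file is representation-theoretic plumbing and discharges none of them.
REL ≠ ★ ≠ BUILT.

## References
[BushnellHenniart2006] C. J. Bushnell, G. Henniart, *The Local Langlands Conjecture for GL(2)*, Grundlehren 335 (2006), §1.1–§2.1, §9.1 ·
[Rogawski1990] J. D. Rogawski, *Automorphic Representations of Unitary Groups in Three Variables*, Ann. of Math. Stud. 123 (1990), §12.1 p. 171
(«`ρ = ρ₁ ⊗ χ`, where `ρ₁` is a representation of `U(2)` and `χ` is a character of `U(1)`»).
-/

set_option autoImplicit false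
-- the mandated namespace (brief §3.4) repeats the single-problem summit's segment (`HodgeConjecture.HodgeConjecture`)
set_option linter.dupNamespace false

namespace Summit.HodgeConjecture.HodgeConjecture.R90.S4

open Literature.NumberTheory.Automorphic

universe u

/-- **The box `c ⊠ χ` of an admissible class is admissible.**  For topological groups `G, G₁`, a character `χ : G₁ →* ℂˣ` with
open kernel and an admissible class `c ∈ Irr(G)` (★ `IrrClass.IsAdmissible`), the class `IrrClass.boxChar χ hχ c ∈ Irr(G × G₁)`
(`⟦r⟧ ↦ ⟦r ⊠ χ⟧`, `(r ⊠ χ)(g, g₁) = χ(g₁) • r(g)`) is admissible: on a representative, `(r ⊠ χ).ρ = (r.ρ ∘ pr₁) ⊗ (χ ∘ pr₂)`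
(★ `SmoothIrrep.boxChar_ρ`) and ★ `isAdmissible_twist_comp_fst` applies (`V^{K}((ρ ∘ pr₁) ⊗ (χ ∘ pr₂)) ≤ V^{pr₁(K ∩ ker(χ ∘ pr₂))}(ρ)`,
finite-dimensional).  Informally: «if `ρ₁` is an admissible representation of `U(2)` and `χ` a character of `U(1)`, then
`ρ₁ ⊗ χ` is an admissible representation of `H = U(2) × U(1)`». [cite: BushnellHenniart2006, §2.1, §9.1] [cite: Rogawski1990, §12.1 p. 171] -/
theorem isAdmissible_boxChar {G G₁ : Type u} [Group G] [TopologicalSpace G] [IsTopologicalGroup G]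
    [Group G₁] [TopologicalSpace G₁] [IsTopologicalGroup G₁]
    (χ : G₁ →* ℂˣ) (hχ : IsOpen ((χ.ker : Subgroup G₁) : Set G₁)) {c : IrrClass G} (h : c.IsAdmissible) :
    (IrrClass.boxChar χ hχ c).IsAdmissible := by
  obtain ⟨r, rfl⟩ := IrrClass.mk_surjective c
  rw [IrrClass.boxChar_mk, IrrClass.isAdmissible_mk, SmoothIrrep.boxChar_ρ]
  exact isAdmissible_twist_comp_fst r.ρ χ ((IrrClass.isAdmissible_mk r).1 h) hχ

end Summit.HodgeConjecture.HodgeConjecture.R90.S4
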